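/-
Copyright (c) 2026 the pub-hodgecm-mathlib formalisation cell (harness21).  Prover seat hodgecm-mathlib-A-p12 (g24), 2026-09-02.  «S3-ram» (LEAD F0P3a-plan (g13); owner p06 (g15);
(Cnt2′) chair F0P3a-p07 (g14)): the W-SIDE PACK of the (α₂) TYPE-(2) line, part 5 — the fixed family is `{zero} ⊔ {rank one}`.  `--supports stmt-HodgeConjecture-24833`.
-/
import Literature.NumberTheory.Rogawski1990.DepthZeroKappaTransferTypeTwoRamifiedWSideCensus   -- ★ (this seat) part 4: `selfDual_fixed_{bd,reg}_eq_empty`; ⊇ parts 1–3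
import HarnessLib

/-!
# The W-side partition: for a 2-deep type-(2) `Γ` of depth `N ≥ 2`, `{B ∣ SD, ΓB = B} = {LEV(ϖ) ∧ LEV(ϖ²)} ⊔ {LEV(ϖ) ∧ ¬LEV(ϖ²) ∧ LEV₂(ϖ³)}` (Labesse–Langlands 1979 §2;
# Kottwitz 1986 §3)

Topic `NumberTheory/Rogawski1990`; namespace `Literature.NumberTheory.Automorphic.UnitaryGroup`.  THEOREMS ONLY; kernel lane `--supports stmt-HodgeConjecture-24833`; cell
`pub/hodgecm-mathlib` (D-0151), crux H413, count-neutral; seat A-p12 (g24).  HONEST LABEL: HC_CM is proved only modulo the 2 remaining named inputs (hLiu418 24832, h413 24833).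

THE MATHEMATICS.  By ★ part 4 the `bd` family (`¬LEV(ϖ)`) and, for `N ≥ 2`, the `reg` family (`LEV(ϖ) ∧ ¬LEV(ϖ²) ∧ ¬LEV₂(ϖ³)`) of a 2-deep type-(2) `Γ ∈ U(σ_w, Φ₂)` are empty, so
the `Γ`-fixed self-dual lattices of `W` split as the ZERO family (`LEV(ϖ) ∧ LEV(ϖ²)`) ⊔ the RANK-ONE family (`LEV(ϖ) ∧ ¬LEV(ϖ²) ∧ LEV₂(ϖ³)`); hence
**`#{rank one} + #{zero} = #{fixed}`** (F0P3a-p07 (g14)'s (z1-e) tokens, lattice currency).  With ★ part 1 (`#zero`) and ★ part 4 (`#fixed`): `#{rank one} = (q+1)·q^(n−1)` at even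
depth `2n` (`n ≥ 1`) and `2·q^n` at odd depth `2n+1` (`n ≥ 1`), split evenly between the classes `CLS(c₀)`, `CLS(εc₀)` by ★ part 2.

* `ncard_selfDual_fixed_rankOne_add_zero_eq`.

## References
* [LabesseLanglands1979] J.-P. Labesse, R. P. Langlands, *L-indistinguishability for SL(2)*, Canad. J. Math. 31 (1979): §2 Lemma 2.1 p. 8.
* [Kottwitz1986] R. Kottwitz, *Base change for unit elements of Hecke algebras*, Compositio Math. 60 (1986): §3.
-/

set_option autoImplicit false

noncomputable section

open MeasureTheory Measure Set NumberField IsDedekindDomain Matrix ValuativeRel MulAction Finset Polynomial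
open scoped ValuativeRel Matrix MatrixGroups WithZero

namespace Literature.NumberTheory.Automorphic.UnitaryGroup

open Literature.NumberTheory.Rogawski1990 Literature.NumberTheory.Automorphic Literature.NumberTheory.Automorphic.IntegralReduction
open Literature.NumberTheory.Automorphic.UnitaryLatticeTree Literature.NumberTheory.Automorphic.HermitianLattice Literature.GroupTheory Literature.NumberTheory.GaloisRepresentations

section Partition

variable (L : Type) [Field L] [NumberField L] [IsCMField L] (v : HeightOneSpectrum (𝓞 ↥(maximalRealSubfield L)))
  (w : PlacesOver L v) (hw : IsCMField.complexConj L • w.1 = w.1)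

set_option maxHeartbeats 800000 in
include hw in
/-- **THE W-SIDE PARTITION `#{rank one} + #{zero} = #{fixed}`** for a 2-deep type-(2) `Γ ∈ U(σ_w, Φ₂)` of discriminant depth `N ≥ 2` whose fixed family is finite: the `Γ`-fixed
self-dual lattices with `LEV(ϖ) ∧ ¬LEV(ϖ²) ∧ LEV₂(ϖ³)` and those with `LEV(ϖ) ∧ LEV(ϖ²)` partition the fixed family (★ `selfDual_fixed_bd_eq_empty`, ★ `selfDual_fixed_reg_eq_empty`).
[cite: LabesseLanglands1979, §2 Lemma 2.1 p. 8] [cite: Kottwitz1986, §3] -/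
theorem ncard_selfDual_fixed_rankOne_add_zero_eq (he : v.asIdeal.ramificationIdx' w.1.asIdeal ≠ 1) (h2 : IsUnit (2 : 𝒪[(w.1.adicCompletion L)]))
    (ϖ : (w.1.adicCompletion L)ˣ) (hϖ : Valued.v (ϖ : (w.1.adicCompletion L)) = WithZero.exp (-1 : ℤ))
    (hσϖ : (galAdicCompletionMap (L := L) (IsCMField.complexConj L) hw) (ϖ : (w.1.adicCompletion L)) = -(ϖ : (w.1.adicCompletion L))) {ϖ' : (w.1.adicCompletion L)}
    (Γ : GL (Fin 2) (w.1.adicCompletion L)) (hΓ : Γ ∈ unitaryGroupOfForm (galAdicCompletionMap (L := L) (IsCMField.complexConj L) hw) (placeForm (Matrix.of fun i j : Fin 2 => if i.val + j.val + 1 = 2 then (1 : L) else 0) w.1))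
    (h2deep : ∀ i j : Fin 2, Valued.v (((Γ : Matrix (Fin 2) (Fin 2) (w.1.adicCompletion L)) - 1) i j) ≤ Valued.v ((ϖ : (w.1.adicCompletion L)) ^ 2))
    {N : ℕ} (hN2 : 2 ≤ N) (hN : Valued.v ((Γ : Matrix (Fin 2) (Fin 2) (w.1.adicCompletion L)).trace ^ 2 - 4 * (Γ : Matrix (Fin 2) (Fin 2) (w.1.adicCompletion L)).det) = WithZero.exp (-((2 * N : ℕ) : ℤ)))
    (hfin : {B : Submodule (Valued.integer (w.1.adicCompletion L)) (Fin 2 → (w.1.adicCompletion L)) | UnitaryLatticeTree.IsSelfDualLattice (galAdicCompletionMap (L := L) (IsCMField.complexConj L) hw) ϖ' (!![(0 : (w.1.adicCompletion L)), 1; 1, 0] : Matrix (Fin 2) (Fin 2) (w.1.adicCompletion L)) B ∧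
        UnitaryLatticeTree.mapGL Γ B = B}.Finite) :
    {B : Submodule (Valued.integer (w.1.adicCompletion L)) (Fin 2 → (w.1.adicCompletion L)) | UnitaryLatticeTree.IsSelfDualLattice (galAdicCompletionMap (L := L) (IsCMField.complexConj L) hw) ϖ' (!![(0 : (w.1.adicCompletion L)), 1; 1, 0] : Matrix (Fin 2) (Fin 2) (w.1.adicCompletion L)) B ∧
        UnitaryLatticeTree.mapGL Γ B = B ∧
        (B.map ((Matrix.toLin' ((Γ : Matrix (Fin 2) (Fin 2) (w.1.adicCompletion L)) - 1)).restrictScalars (Valued.integer (w.1.adicCompletion L))) ≤ UnitaryLatticeTree.scaleLattice (ϖ : (w.1.adicCompletion L)) B ∧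
          ¬ B.map ((Matrix.toLin' ((Γ : Matrix (Fin 2) (Fin 2) (w.1.adicCompletion L)) - 1)).restrictScalars (Valued.integer (w.1.adicCompletion L))) ≤ UnitaryLatticeTree.scaleLattice ((ϖ : (w.1.adicCompletion L)) ^ 2) B ∧
          B.map ((Matrix.toLin' (((Γ : Matrix (Fin 2) (Fin 2) (w.1.adicCompletion L)) - 1) ^ 2)).restrictScalars (Valued.integer (w.1.adicCompletion L))) ≤ UnitaryLatticeTree.scaleLattice ((ϖ : (w.1.adicCompletion L)) ^ 3) B)}.ncard +
    {B : Submodule (Valued.integer (w.1.adicCompletion L)) (Fin 2 → (w.1.adicCompletion L)) | UnitaryLatticeTree.IsSelfDualLattice (galAdicCompletionMap (L := L) (IsCMField.complexConj L) hw) ϖ' (!![(0 : (w.1.adicCompletion L)), 1; 1, 0] : Matrix (Fin 2) (Fin 2) (w.1.adicCompletion L)) B ∧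
        UnitaryLatticeTree.mapGL Γ B = B ∧
        (B.map ((Matrix.toLin' ((Γ : Matrix (Fin 2) (Fin 2) (w.1.adicCompletion L)) - 1)).restrictScalars (Valued.integer (w.1.adicCompletion L))) ≤ UnitaryLatticeTree.scaleLattice (ϖ : (w.1.adicCompletion L)) B ∧
          B.map ((Matrix.toLin' ((Γ : Matrix (Fin 2) (Fin 2) (w.1.adicCompletion L)) - 1)).restrictScalars (Valued.integer (w.1.adicCompletion L))) ≤ UnitaryLatticeTree.scaleLattice ((ϖ : (w.1.adicCompletion L)) ^ 2) B)}.ncard =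
    {B : Submodule (Valued.integer (w.1.adicCompletion L)) (Fin 2 → (w.1.adicCompletion L)) | UnitaryLatticeTree.IsSelfDualLattice (galAdicCompletionMap (L := L) (IsCMField.complexConj L) hw) ϖ' (!![(0 : (w.1.adicCompletion L)), 1; 1, 0] : Matrix (Fin 2) (Fin 2) (w.1.adicCompletion L)) B ∧
        UnitaryLatticeTree.mapGL Γ B = B}.ncard := by
  have hbd := selfDual_fixed_bd_eq_empty L v w hw he h2 ϖ hϖ hσϖ (ϖ' := ϖ') Γ hΓ h2deep (by omega : 1 ≤ N) hN
  have hreg := selfDual_fixed_reg_eq_empty L v w hw he h2 ϖ hϖ hσϖ (ϖ' := ϖ') Γ hΓ h2deep hN2 hN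
  -- every fixed `B` has `LEV(ϖ)`; a fixed `B` with `¬LEV(ϖ²)` has `LEV₂(ϖ³)`
  have hlev : ∀ B : Submodule (Valued.integer (w.1.adicCompletion L)) (Fin 2 → (w.1.adicCompletion L)), UnitaryLatticeTree.IsSelfDualLattice (galAdicCompletionMap (L := L) (IsCMField.complexConj L) hw) ϖ' (!![(0 : (w.1.adicCompletion L)), 1; 1, 0] : Matrix (Fin 2) (Fin 2) (w.1.adicCompletion L)) B →
      UnitaryLatticeTree.mapGL Γ B = B → B.map ((Matrix.toLin' ((Γ : Matrix (Fin 2) (Fin 2) (w.1.adicCompletion L)) - 1)).restrictScalars (Valued.integer (w.1.adicCompletion L))) ≤ UnitaryLatticeTree.scaleLattice (ϖ : (w.1.adicCompletion L)) B := by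
    intro B hsd hfix
    by_contra hnot
    have hmem : B ∈ ({B : Submodule (Valued.integer (w.1.adicCompletion L)) (Fin 2 → (w.1.adicCompletion L)) | UnitaryLatticeTree.IsSelfDualLattice (galAdicCompletionMap (L := L) (IsCMField.complexConj L) hw) ϖ' (!![(0 : (w.1.adicCompletion L)), 1; 1, 0] : Matrix (Fin 2) (Fin 2) (w.1.adicCompletion L)) B ∧
        UnitaryLatticeTree.mapGL Γ B = B ∧
        ¬ B.map ((Matrix.toLin' ((Γ : Matrix (Fin 2) (Fin 2) (w.1.adicCompletion L)) - 1)).restrictScalars (Valued.integer (w.1.adicCompletion L))) ≤ UnitaryLatticeTree.scaleLattice (ϖ : (w.1.adicCompletion L)) B}) := ⟨hsd, hfix, hnot⟩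
    rw [hbd] at hmem
    exact hmem
  have hlev2 : ∀ B : Submodule (Valued.integer (w.1.adicCompletion L)) (Fin 2 → (w.1.adicCompletion L)), UnitaryLatticeTree.IsSelfDualLattice (galAdicCompletionMap (L := L) (IsCMField.complexConj L) hw) ϖ' (!![(0 : (w.1.adicCompletion L)), 1; 1, 0] : Matrix (Fin 2) (Fin 2) (w.1.adicCompletion L)) B →
      UnitaryLatticeTree.mapGL Γ B = B → ¬ B.map ((Matrix.toLin' ((Γ : Matrix (Fin 2) (Fin 2) (w.1.adicCompletion L)) - 1)).restrictScalars (Valued.integer (w.1.adicCompletion L))) ≤ UnitaryLatticeTree.scaleLattice ((ϖ : (w.1.adicCompletion L)) ^ 2) B →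
      B.map ((Matrix.toLin' (((Γ : Matrix (Fin 2) (Fin 2) (w.1.adicCompletion L)) - 1) ^ 2)).restrictScalars (Valued.integer (w.1.adicCompletion L))) ≤ UnitaryLatticeTree.scaleLattice ((ϖ : (w.1.adicCompletion L)) ^ 3) B := by
    intro B hsd hfix hnot2
    by_contra hnot3
    have hmem : B ∈ ({B : Submodule (Valued.integer (w.1.adicCompletion L)) (Fin 2 → (w.1.adicCompletion L)) | UnitaryLatticeTree.IsSelfDualLattice (galAdicCompletionMap (L := L) (IsCMField.complexConj L) hw) ϖ' (!![(0 : (w.1.adicCompletion L)), 1; 1, 0] : Matrix (Fin 2) (Fin 2) (w.1.adicCompletion L)) B ∧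
        UnitaryLatticeTree.mapGL Γ B = B ∧
        (B.map ((Matrix.toLin' ((Γ : Matrix (Fin 2) (Fin 2) (w.1.adicCompletion L)) - 1)).restrictScalars (Valued.integer (w.1.adicCompletion L))) ≤ UnitaryLatticeTree.scaleLattice (ϖ : (w.1.adicCompletion L)) B ∧
          ¬ B.map ((Matrix.toLin' ((Γ : Matrix (Fin 2) (Fin 2) (w.1.adicCompletion L)) - 1)).restrictScalars (Valued.integer (w.1.adicCompletion L))) ≤ UnitaryLatticeTree.scaleLattice ((ϖ : (w.1.adicCompletion L)) ^ 2) B ∧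
          ¬ B.map ((Matrix.toLin' (((Γ : Matrix (Fin 2) (Fin 2) (w.1.adicCompletion L)) - 1) ^ 2)).restrictScalars (Valued.integer (w.1.adicCompletion L))) ≤ UnitaryLatticeTree.scaleLattice ((ϖ : (w.1.adicCompletion L)) ^ 3) B)}) :=
      ⟨hsd, hfix, hlev B hsd hfix, hnot2, hnot3⟩
    rw [hreg] at hmem
    exact hmem
  rw [← Set.ncard_union_eq ?_ (hfin.subset ?_) (hfin.subset ?_)]
  · congr 1
    ext B
    simp only [Set.mem_union, Set.mem_setOf_eq]
    constructor
    · rintro (⟨hsd, hfix, -⟩ | ⟨hsd, hfix, -⟩) <;> exact ⟨hsd, hfix⟩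
    · rintro ⟨hsd, hfix⟩
      by_cases h2l : B.map ((Matrix.toLin' ((Γ : Matrix (Fin 2) (Fin 2) (w.1.adicCompletion L)) - 1)).restrictScalars (Valued.integer (w.1.adicCompletion L))) ≤ UnitaryLatticeTree.scaleLattice ((ϖ : (w.1.adicCompletion L)) ^ 2) B
      · exact Or.inr ⟨hsd, hfix, hlev B hsd hfix, h2l⟩
      · exact Or.inl ⟨hsd, hfix, hlev B hsd hfix, h2l, hlev2 B hsd hfix h2l⟩
  · rw [Set.disjoint_left]
    rintro B ⟨-, -, -, hnot2, -⟩ ⟨-, -, -, h2l⟩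
    exact hnot2 h2l
  · rintro B ⟨hsd, hfix, -⟩; exact ⟨hsd, hfix⟩
  · rintro B ⟨hsd, hfix, -⟩; exact ⟨hsd, hfix⟩

end Partition

end Literature.NumberTheory.Automorphic.UnitaryGroup

end
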